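import Summits.PneNP.PneNP.Theorems.SymmetryBudgetWindowBarrierEntropyGameSize
import Summits.PneNP.PneNP.Theorems.SymmetryBudgetWindowBarrierTwinIsoCapstone
import Summits.PneNP.PneNP.Theorems.SymmetryBudgetNoHiddenOrderIffNotWindowBarrier
import Literature.Computability.Complexity.GraphCanonizationProgram

/-!
# The dichotomy `WindowBarrier` (stmt-PneNP-2145) / `NoHiddenOrder` (stmt-PneNP-14781) with the
# literature debt paid: unconditional capstones

Route `PneNP/SymmetryBudget`.  Every capstone of the crux chain of `WindowBarrier` carried the named
fact `babaiLuks1983_canonicalForm` (canonical forms of vertex-coloured graphs in simply-exponential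
time, Babai–Luks 1983 / Corneil–Goldberg 1984) as a hypothesis: `windowBarrier_of_twinIsoHard`,
`windowBarrier_of_hardToIdentify` (`…TwinIsoCapstone.lean`), `windowBarrier_of_entropyGames`,
`not_noHiddenOrder_of_entropyGames` (`…EntropyGame.lean`).  That fact is now PROVED in the tree
(`Literature.Computability.Complexity.babaiLuks1983_canonicalForm_holds`,
`Literature/Computability/Complexity/GraphCanonizationProgram.lean`: a Corneil–Goldberg canoniser with
switched-graph sections, `≤ 2^{14k+1}` recursion nodes, run as a polynomial-time string program).
This file records the resulting UNCONDITIONAL statements, so that the two items read, verbatim from the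
tree:

* `windowBarrier_from_hardToIdentify` : HardToIdentify → `WindowBarrier`;
* `windowBarrier_from_twinIsoHard`    : TwinIsoHard → `WindowBarrier`;
* `windowBarrier_from_entropyGames`   : (∀ K, ∃ᶠ n, ∃ non-isomorphic `G H` with an entropy-`K` game) →
  `WindowBarrier`, and `not_noHiddenOrder_from_entropyGames` : … → `¬ NoHiddenOrder`;
* the contrapositives for the positive crux stmt-PneNP-14781: `not_hardToIdentify_of_noHiddenOrder`
  (`NoHiddenOrder` forces, for some rate `c`, eventually EVERY isomorphism type on `Fin h` to have a
  `Sym(Fin h)`-symmetric threshold circuit of size `≤ 2^{ch}`) and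
  `entropyGame_isIso_of_noHiddenOrder` (`NoHiddenOrder` forces some entropy level `K` at which, for all
  large `n`, an entropy-`K` game between graphs on `Fin n` exists only between isomorphic graphs — with
  `CosetGame.EntropyGame.ofIso`, the game IS isomorphism eventually).

So, after this file: `WindowBarrier` ⟸ HardToIdentify ⟺ (entropy games for every `K`)
(`hardToIdentify_iff_entropyGames`), and `NoHiddenOrder` ⟹ ¬HardToIdentify ⟺ (entropy games
characterise isomorphism at some level); what is NOT known is the converse
`¬HardToIdentify → NoHiddenOrder` (identification versus canonisation in the window).
No definitions, no sorry, no new Literature facts.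
-/

set_option linter.dupNamespace false -- `Summit.PneNP.PneNP.…`: summit = sub-problem name (D-0017 single-conjunct layout)

namespace Summit.PneNP.PneNP.Theorems

open Filter Literature.Computability.Complexity Summit.PneNP.PneNP.Theses.SymmetryBudget
open scoped Classical

/-- **HardToIdentify → `WindowBarrier`, unconditionally**: the capstone
`windowBarrier_of_hardToIdentify` with its Babai–Luks hypothesis discharged by
`babaiLuks1983_canonicalForm_holds`. -/
theorem windowBarrier_from_hardToIdentify : (∀ c : ℕ, ∃ᶠ h in Filter.atTop, ∃ H : SimpleGraph (Fin h), ¬ Literature.Computability.Complexity.HasSymCircuit Literature.Computability.Complexity.tcBasis Set.univ (2 ^ (c * h)) (fun x : Fin h × Fin h → Bool => @decide (Nonempty ((SimpleGraph.fromRel fun u v => x (u, v) = true) ≃g H)) (Classical.propDecidable _))) → Summit.PneNP.PneNP.Theses.SymmetryBudget.WindowBarrier := fun hHTI =>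
  windowBarrier_of_hardToIdentify babaiLuks1983_canonicalForm_holds hHTI

/-- **TwinIsoHard → `WindowBarrier`, unconditionally** (`windowBarrier_of_twinIsoHard` with the
Babai–Luks hypothesis discharged). -/
theorem windowBarrier_from_twinIsoHard
    (hH : ∀ p : Polynomial ℕ, ∃ᶠ m in atTop,
      ¬ HasSymCircuit tcBasis (pointStabiliserBudget m (Nat.log 2 m)) (p.eval m)
        (fun x : Fin m × Fin m → Bool => decide (Nonempty
          (SimpleGraph.induce {u : Fin m | m ≤ (u : ℕ) + Nat.log 2 m ∧ ∃ h : 0 < m,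
                (SimpleGraph.fromRel fun u v => x (u, v) = true).Adj ⟨0, h⟩ u}
              (SimpleGraph.fromRel fun u v => x (u, v) = true) ≃g
            SimpleGraph.induce {u : Fin m | m ≤ (u : ℕ) + Nat.log 2 m ∧ ¬ ∃ h : 0 < m,
                (SimpleGraph.fromRel fun u v => x (u, v) = true).Adj ⟨0, h⟩ u}
              (SimpleGraph.fromRel fun u v => x (u, v) = true))))) :
    WindowBarrier :=
  windowBarrier_of_twinIsoHard babaiLuks1983_canonicalForm_holds hH

/-- **Entropy games for every `K` prove `WindowBarrier`, unconditionally**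
(`windowBarrier_of_entropyGames` with the Babai–Luks hypothesis discharged): the S-side of crux
stmt-PneNP-2145 is now EXACTLY a Duplicator strategy in the entropy-`K` game on non-isomorphic pairs,
for every `K`, infinitely often. -/
theorem windowBarrier_from_entropyGames
    (h : ∀ K : ℕ, ∃ᶠ n in atTop, ∃ G H : SimpleGraph (Fin n),
      ¬ Nonempty (G ≃g H) ∧ Nonempty (CosetGame.EntropyGame K G H)) :
    WindowBarrier :=
  windowBarrier_of_entropyGames babaiLuks1983_canonicalForm_holds h

/-- **… and refute `NoHiddenOrder`, unconditionally** (crux stmt-PneNP-14781 is the literal negation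
of `WindowBarrier`). -/
theorem not_noHiddenOrder_from_entropyGames
    (h : ∀ K : ℕ, ∃ᶠ n in atTop, ∃ G H : SimpleGraph (Fin n),
      ¬ Nonempty (G ≃g H) ∧ Nonempty (CosetGame.EntropyGame K G H)) :
    ¬ NoHiddenOrder :=
  not_noHiddenOrder_of_entropyGames babaiLuks1983_canonicalForm_holds h

/-- **HardToIdentify refutes `NoHiddenOrder`** (contrapositive packaging for the positive crux). -/
theorem not_noHiddenOrder_from_hardToIdentify
    (hHTI : ∀ c : ℕ, ∃ᶠ h in atTop, ∃ H : SimpleGraph (Fin h),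
      ¬ HasSymCircuit tcBasis Set.univ (2 ^ (c * h))
        (fun x : Fin h × Fin h → Bool =>
          decide (Nonempty ((SimpleGraph.fromRel fun u v => x (u, v) = true) ≃g H)))) :
    ¬ NoHiddenOrder := fun hN =>
  noHiddenOrder_iff_not_windowBarrier.1 hN (windowBarrier_from_hardToIdentify hHTI)

/-- **`NoHiddenOrder` forces symmetric identification in the exponential window**: if the positive
crux stmt-PneNP-14781 holds then for some rate `c`, for all large `h`, EVERY graph `H` on `Fin h` has a
`Sym(Fin h)`-symmetric `tcBasis`-circuit of size `≤ 2^{ch}` deciding `x ↦ [Gr x ≅ H]` — the negation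
of the open core HardToIdentify of the sibling crux, now with no literature hypothesis. -/
theorem not_hardToIdentify_of_noHiddenOrder (hN : NoHiddenOrder) :
    ∃ c : ℕ, ∀ᶠ h in atTop, ∀ H : SimpleGraph (Fin h),
      HasSymCircuit tcBasis Set.univ (2 ^ (c * h))
        (fun x : Fin h × Fin h → Bool =>
          decide (Nonempty ((SimpleGraph.fromRel fun u v => x (u, v) = true) ≃g H))) := by
  by_contra hc
  refine not_noHiddenOrder_from_hardToIdentify (fun c => ?_) hN
  have hc' := not_exists.1 hc c
  rw [Filter.not_eventually] at hc'
  refine hc'.mono fun h hh => ?_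
  simpa only [not_forall] using hh

/-- **`NoHiddenOrder` forces the entropy game to BE isomorphism at some level**: if stmt-PneNP-14781
holds then there is an entropy level `K` such that, for all large `n`, two graphs on `Fin n` admitting an
entropy-`K` game are isomorphic (the converse, `CosetGame.EntropyGame.ofIso`, holds at every level).
Contrapositive of `not_noHiddenOrder_from_entropyGames`. -/
theorem entropyGame_isIso_of_noHiddenOrder (hN : NoHiddenOrder) :
    ∃ K : ℕ, ∀ᶠ n in atTop, ∀ G H : SimpleGraph (Fin n),
      Nonempty (CosetGame.EntropyGame K G H) → Nonempty (G ≃g H) := by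
  by_contra hK
  refine not_noHiddenOrder_from_entropyGames (fun K => ?_) hN
  have hK' := not_exists.1 hK K
  rw [Filter.not_eventually] at hK'
  refine hK'.mono fun n hn => ?_
  simp only [not_forall, exists_prop] at hn
  obtain ⟨G, H, hgame, hiso⟩ := hn
  exact ⟨G, H, hiso, hgame⟩

end Summit.PneNP.PneNP.Theorems
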